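import Summits.NavierStokesRegularity.FluidComputer.ClayBlowupConcentration
import Literature.Analysis.FluidPDE.TsaiTopSingularNullHolds
import Mathlib.MeasureTheory.Measure.Hausdorff
import HarnessLib

/-!
# THE SINGULAR SLICE OF AN UNFORCED CLAY BLOW-UP IS `ℋ¹`-NULL: a counterexample to Clay (A) blows
# up for the first time on a nonempty compact set of one-dimensional Hausdorff measure zero

Cell `ns-blowup`, seat `ns-blowup-ecbridge-2` (g7; the E–C endpoint theory seat). LABEL: E–C typing
(KERNEL — no named fact). WHAT THIS IS NOT: not Navier–Stokes evidence — a necessary condition on the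
TYPE `ClayBlowup ν` with zero force (no inhabitant is claimed anywhere; an inhabitant would be exactly a
counterexample to Fefferman's (A), `navierStokesRegularity_iff_forall_designedBlowup_force_ne_zero`).
Companion memo: `run/shared/lean/pub/ns-blowup/ecbridge2/ECBRIDGE-2-MEMO-6.md`.

## Content (Caffarelli–Kohn–Nirenberg's Theorem B at the first blow-up time, unforced)

`ClayBlowupSingularSliceNull.lean` (g6) proved `μH[2] S_T = 0` for the singular slice
`S_T = {x₀ | u is not backward bounded at (T, x₀)}` of every Clay blow-up, from the ONE-SCALE
ε-regularity criterion (the `|u|³ + |p|^{3/2}` functional). The known optimum is one dimension lower: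
Caffarelli–Kohn–Nirenberg's Theorem B (`𝒫¹(S) = 0`), whose proof runs the Vitali covering argument with
the GRADIENT criterion (Proposition 2). At the top slice of a cylinder this is Tsai 1998, Lemma 4.2 and
the remark following it — in the tree the PROVED theorem `tsai1998_top_singular_null_holds` (zero force).
Hence, for an UNFORCED Clay blow-up (`X.f = 0`):

* `ClayBlowup.isBackwardSingularPoint_of_not_isBackwardBoundedAt` — a point of the singular slice is a
  backward singular point in the essential-supremum sense of `IsBackwardSingularPoint` (continuity of
  `u` below `T` turns an essential bound on a backward cylinder into a pointwise one);
* `ClayBlowup.hausdorffMeasure_one_singularSlice_inter_ball_eq_zero_of_force_eq_zero` — Tsai's theorem on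
  the backward cylinder `Q_ρ(T, c)`, `ρ = √(T/2)`, fed with the through-`T` classes of the type
  (`isSuitableWeakSolutionOn_normalisedPressure`, `exists_isLRSuitableWeakSolutionOn_cylinder_top`);
* **`ClayBlowup.hausdorffMeasure_one_singularSlice_eq_zero_of_force_eq_zero`** — `μH[1] S_T = 0`
  (finite cover of the compact slice `isCompact_singularSlice` by such balls): an unforced Clay blow-up
  has NO first-time singular curve of positive length (no filament or vortex-ring collapse onto a
  circle), only a nonempty compact `ℋ¹`-null set, each point of which carries the CKN concentration
  `ckn_concentration`;
* the `DesignedBlowup` twin and the (A)-side corollary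
  `exists_unforced_clayBlowup_of_not_navierStokesRegularity`: if Clay (A) fails, some unforced Clay
  blow-up exists, and every one of them has a nonempty compact `ℋ¹`-null singular slice.

The forced case (the (C) type) needs Tsai's Lemma 4.2 WITH force and is not claimed here.

References: T.-P. Tsai, ARMA 143 (1998), Lemma 4.2 and the following remark (p. 46)
[cite: Tsai1998, Lemma 4.2 (p. 46)]; L. Caffarelli, R. Kohn, L. Nirenberg, CPAM 35 (1982), Thm. B,
Prop. 2, §6 (p. 807) [cite: CaffarelliKohnNirenberg1982, Theorem B]; P. G. Lemarié-Rieusset (2016),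
Thm. 13.9 (p. 479) and p. 771 [cite: LemarieRieusset2016, Thm. 13.9]; C. L. Fefferman, Clay problem
description, (A), (C) [cite: FeffermanClay2006, (A)].
-/

noncomputable section

namespace Summit.NavierStokesRegularity.FluidComputer

open Set MeasureTheory Filter Topology Function TopologicalSpace Metric
open scoped ENNReal ContDiff NNReal
open Literature.Analysis.FluidPDE
open Summit.NavierStokesRegularity.NavierStokesRegularity
open Summit.NavierStokesRegularity.FluidComputer.PalasekTowerClayBridge

namespace ClayBlowup

variable {ν : ℝ} (X : ClayBlowup ν)

/-! ## §1 Points of the singular slice are backward singular points -/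

/-- **A point of the singular slice of a Clay blow-up is a backward singular point** in the sense of
`IsBackwardSingularPoint` (`u` essentially unbounded on every backward cylinder `Q_r(T, x₀)`): if `u`
were essentially bounded on some `Q_r(T, x₀)`, it would be essentially bounded on
`Q_{r'}(T, x₀)`, `r' = min r √(T/2)`, an open set on which `u` is continuous (`t ≥ T/2 > 0`), hence
pointwise bounded there. [cite: CaffarelliKohnNirenberg1982, §6 (regular points)] -/
theorem isBackwardSingularPoint_of_not_isBackwardBoundedAt {x₀ : EuclideanSpace ℝ (Fin 3)}
    (hx₀ : ¬ IsBackwardBoundedAt X.u X.T x₀) : IsBackwardSingularPoint X.u (X.T, x₀) := by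
  have hT := X.T_pos
  intro r hr
  by_contra hne
  have hlt : eLpNorm (uncurry X.u) ⊤ (volume.restrict (parabolicCylinder r ((X.T : ℝ), x₀))) < ⊤ :=
    lt_top_iff_ne_top.2 hne
  -- the smaller cylinder `Q_{r'}(T, x₀)`, `r' = min r √(T/2)`, lies in `[T/2, T) × ℝ³`
  set r' : ℝ := min r (Real.sqrt (X.T / 2)) with hr'
  have hr'0 : 0 < r' := lt_min hr (Real.sqrt_pos.2 (by positivity))
  have hr'r : r' ≤ r := min_le_left _ _
  have hr'sq : r' ^ 2 ≤ X.T / 2 := by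
    calc r' ^ 2 ≤ Real.sqrt (X.T / 2) ^ 2 := pow_le_pow_left₀ hr'0.le (min_le_right _ _) 2
      _ = X.T / 2 := Real.sq_sqrt (by positivity)
  have hsub : parabolicCylinder r' ((X.T : ℝ), x₀) ⊆ parabolicCylinder r ((X.T : ℝ), x₀) := by
    intro w hw
    rw [mem_parabolicCylinder] at hw ⊢
    have : r' ^ 2 ≤ r ^ 2 := pow_le_pow_left₀ hr'0.le hr'r 2
    exact ⟨⟨by linarith [hw.1.1], hw.1.2⟩, lt_of_lt_of_le hw.2 hr'r⟩
  -- the essential bound on the smaller cylinder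
  set M : ℝ≥0∞ := eLpNorm (uncurry X.u) ⊤ (volume.restrict (parabolicCylinder r ((X.T : ℝ), x₀)))
    with hM
  have hMt : M ≠ ⊤ := hlt.ne
  have hae : ∀ᵐ w ∂(volume.restrict (parabolicCylinder r' ((X.T : ℝ), x₀))), ‖uncurry X.u w‖ ≤ M.toReal := by
    have h1 : ∀ᵐ w ∂(volume.restrict (parabolicCylinder r ((X.T : ℝ), x₀))), ‖uncurry X.u w‖ₑ ≤ M := by
      rw [hM, eLpNorm_exponent_top]
      exact ae_le_eLpNormEssSup
    have h2 := ae_restrict_of_ae_restrict_of_subset hsub h1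
    filter_upwards [h2] with w hw
    rw [← ofReal_norm] at hw
    exact (ENNReal.ofReal_le_iff_le_toReal hMt).1 hw
  -- continuity below `T` makes it a pointwise bound
  have hcont : ContinuousOn (uncurry X.u) (parabolicCylinder r' ((X.T : ℝ), x₀)) := by
    refine X.classical.smooth_velocity.continuousOn.mono fun w hw => ?_
    rw [mem_parabolicCylinder] at hw
    exact ⟨⟨by nlinarith [hw.1.1], hw.1.2⟩, mem_univ _⟩
  have hall := SereginSverak2002.norm_le_of_ae_restrict_of_continuousOn
    (isOpen_parabolicCylinder _ _) hcont hae
  refine hx₀ ⟨r', hr'0, M.toReal, fun t ht x hx => hall (t, x) ?_⟩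
  rw [mem_parabolicCylinder]
  exact ⟨ht, mem_ball.1 hx⟩

/-- The singular slice is contained in the backward singular points of the top slice (set form of
`isBackwardSingularPoint_of_not_isBackwardBoundedAt`, intersected with a ball).
[cite: CaffarelliKohnNirenberg1982, §6 (regular points)] -/
theorem singularSlice_inter_ball_subset (c : EuclideanSpace ℝ (Fin 3)) (ρ : ℝ) :
    {x₀ : EuclideanSpace ℝ (Fin 3) | ¬ IsBackwardBoundedAt X.u X.T x₀} ∩ ball c ρ ⊆
      {x ∈ ball c ρ | IsBackwardSingularPoint X.u (X.T, x)} := fun _ hx =>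
  ⟨hx.2, X.isBackwardSingularPoint_of_not_isBackwardBoundedAt hx.1⟩

/-! ## §2 Tsai's theorem on a backward cylinder whose top is the lifespan (zero force) -/

/-- **`ℋ¹`-NULLITY OF THE SINGULAR SLICE INSIDE ONE BALL** for an UNFORCED Clay blow-up (`ν > 0`,
`X.f = 0`): for every centre `c`, `μH[1] ({x₀ | ¬ IsBackwardBoundedAt u T x₀} ∩ B(c, √(T/2))) = 0`.
Tsai 1998, Lemma 4.2 and the following remark (the tree theorem `tsai1998_top_singular_null_holds`:
CKN's Theorem-B covering argument with the backward gradient criterion at the top of the cylinder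
`Q_ρ(T, c) = (T/2, T) × B(c, ρ)`, `ρ = √(T/2)`), whose hypotheses are the through-`T` classes of the type:
the unforced suitable weak solution `(u, p̃[u])` on the open lifespan slab restricted to the cylinder
(`isSuitableWeakSolutionOn_normalisedPressure`, `forcePotential_zero`), ONE energy bound
(`energy_le`), the classical derivative as weak gradient with integrable dissipation and
`p̃[u] ∈ L^{3/2}` on the cylinder (`exists_isLRSuitableWeakSolutionOn_cylinder_top`). No named fact.
[cite: Tsai1998, Lemma 4.2 and the following remark (p. 46)] [cite: CaffarelliKohnNirenberg1982, Theorem B (§6, p. 807)] -/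
theorem hausdorffMeasure_one_singularSlice_inter_ball_eq_zero_of_force_eq_zero (hν : 0 < ν)
    (hf : X.f = 0) (c : EuclideanSpace ℝ (Fin 3)) :
    μH[1] ({x₀ : EuclideanSpace ℝ (Fin 3) | ¬ IsBackwardBoundedAt X.u X.T x₀} ∩
      ball c (Real.sqrt (X.T / 2))) = 0 := by
  have hT := X.T_pos
  set ρ : ℝ := Real.sqrt (X.T / 2) with hρ
  have hρ0 : 0 < ρ := Real.sqrt_pos.2 (by positivity)
  have hρsq : ρ ^ 2 = X.T / 2 := Real.sq_sqrt (by positivity)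
  have hρT : ρ ^ 2 ≤ X.T := by rw [hρsq]; linarith
  -- the cylinder inside the open lifespan slab
  set Ω : Opens (ℝ × EuclideanSpace ℝ (Fin 3)) := parabolicCylinderOpens ρ ((X.T : ℝ), c) with hΩdef
  have hΩ : (Ω : Set (ℝ × EuclideanSpace ℝ (Fin 3))) = parabolicCylinder ρ ((X.T : ℝ), c) := rfl
  have hΩle : Ω ≤ slab (EuclideanSpace ℝ (Fin 3)) (Ioo 0 X.T) isOpen_Ioo := by
    intro z hz
    have hz' : z ∈ parabolicCylinder ρ ((X.T : ℝ), c) := hz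
    rw [mem_parabolicCylinder] at hz'
    exact mem_slab.2 ⟨by nlinarith [hz'.1.1], hz'.1.2⟩
  -- (1) the unforced suitable weak solution `(u, p_N)` on the cylinder
  have hsw := (X.isSuitableWeakSolutionOn_normalisedPressure hν).of_le hΩle
  rw [hf] at hsw
  -- (2) the energy class on the cylinder
  obtain ⟨E, hEt, hE⟩ := X.energy_le hν
  have henergy : ∃ C : ℝ≥0, ∀ᵐ t : ℝ, t ∈ Ioo (X.T - ρ ^ 2) X.T →
      ∫⁻ x in ball c ρ, ‖X.u t x‖ₑ ^ 2 ≤ C := by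
    refine ⟨E.toNNReal, ae_of_all _ fun t ht => ?_⟩
    rw [ENNReal.coe_toNNReal hEt.ne]
    exact (setLIntegral_le_lintegral _ _).trans (hE t ⟨by nlinarith [ht.1], ht.2⟩)
  -- (3), (4) the weak gradient with integrable dissipation and `p_N ∈ L^{3/2}` on the cylinder
  obtain ⟨G, hLR⟩ := X.exists_isLRSuitableWeakSolutionOn_cylinder_top hν c hρ0 hρT
  have hgrad : ∃ G : ℝ → EuclideanSpace ℝ (Fin 3) →
      EuclideanSpace ℝ (Fin 3) →L[ℝ] EuclideanSpace ℝ (Fin 3),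
      HasWeakSpatialGradientOn (parabolicCylinderOpens ρ ((X.T : ℝ), c)) X.u G ∧
      ∫⁻ z in parabolicCylinder ρ ((X.T : ℝ), c),
        ENNReal.ofReal (frobeniusNormSq (G z.1 z.2)) < ⊤ :=
    ⟨G, hLR.weakGradient, hLR.gradient_lt_top⟩
  have hp : ∫⁻ z in parabolicCylinder ρ ((X.T : ℝ), c),
      ‖normalisedPressure (X.u z.1) z.2 + forcePotential (X.f z.1) z.2‖ₑ ^ (3 / 2 : ℝ) < ⊤ :=
    hLR.pressure_lt_top
  rw [hf] at hp
  -- Tsai's theorem at the top of the cylinder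
  have hnull := tsai1998_top_singular_null_holds hν hρ0 hsw henergy hgrad hp
  exact measure_mono_null (X.singularSlice_inter_ball_subset c ρ) hnull

/-! ## §3 The singular slice of an unforced Clay blow-up is `ℋ¹`-null -/

/-- **THE SINGULAR SLICE OF AN UNFORCED CLAY BLOW-UP HAS ONE-DIMENSIONAL HAUSDORFF MEASURE ZERO**
(`ν > 0`, `X.f = 0`): `μH[1] {x₀ | ¬ IsBackwardBoundedAt u T x₀} = 0`. Caffarelli–Kohn–Nirenberg's
Theorem B at the first blow-up time: the compact singular slice (`isCompact_singularSlice`) is covered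
by finitely many balls of radius `√(T/2)`, on each of which Tsai's top-slice theorem applies
(`hausdorffMeasure_one_singularSlice_inter_ball_eq_zero_of_force_eq_zero`). Reading: a blow-up scenario
against Clay (A) whose singular set at the blow-up time contains a CURVE OF POSITIVE LENGTH (a vortex
filament or ring collapsing onto a circle, a sheet, a volume) is not a Clay blow-up; what survives is a
nonempty compact `ℋ¹`-null set. No named fact. [cite: CaffarelliKohnNirenberg1982, Theorem B (§6, p. 807)]
[cite: Tsai1998, Lemma 4.2 and the following remark (p. 46)] [cite: LemarieRieusset2016, Thm. 13.9 (p. 479) and p. 771] -/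
theorem hausdorffMeasure_one_singularSlice_eq_zero_of_force_eq_zero (hν : 0 < ν) (hf : X.f = 0) :
    μH[1] {x₀ : EuclideanSpace ℝ (Fin 3) | ¬ IsBackwardBoundedAt X.u X.T x₀} = 0 := by
  have hT := X.T_pos
  set S : Set (EuclideanSpace ℝ (Fin 3)) :=
    {x₀ : EuclideanSpace ℝ (Fin 3) | ¬ IsBackwardBoundedAt X.u X.T x₀} with hS
  have hρ0 : 0 < Real.sqrt (X.T / 2) := Real.sqrt_pos.2 (by positivity)
  obtain ⟨t, -, htfin, hcover⟩ := finite_cover_balls_of_compact (X.isCompact_singularSlice hν).1 hρ0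
  have hSU : S ⊆ ⋃ c ∈ t, S ∩ ball c (Real.sqrt (X.T / 2)) := by
    intro x hx
    obtain ⟨c, hc, hxc⟩ := mem_iUnion₂.1 (hcover hx)
    exact mem_iUnion₂.2 ⟨c, hc, hx, hxc⟩
  refine measure_mono_null hSU ((measure_biUnion_null_iff htfin.countable).2 fun c _ => ?_)
  exact X.hausdorffMeasure_one_singularSlice_inter_ball_eq_zero_of_force_eq_zero hν hf c

/-- **Summary row for an unforced Clay blow-up** (`ν > 0`, `X.f = 0`): the singular slice is a
NONEMPTY COMPACT `ℋ¹`-NULL set (`isCompact_singularSlice` and the theorem above). No named fact.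
[cite: CaffarelliKohnNirenberg1982, Theorem B (§6, p. 807)] -/
theorem singularSlice_compact_nonempty_hausdorffOne_null_of_force_eq_zero (hν : 0 < ν)
    (hf : X.f = 0) :
    IsCompact {x₀ : EuclideanSpace ℝ (Fin 3) | ¬ IsBackwardBoundedAt X.u X.T x₀} ∧
      {x₀ : EuclideanSpace ℝ (Fin 3) | ¬ IsBackwardBoundedAt X.u X.T x₀}.Nonempty ∧
        μH[1] {x₀ : EuclideanSpace ℝ (Fin 3) | ¬ IsBackwardBoundedAt X.u X.T x₀} = 0 :=
  ⟨(X.isCompact_singularSlice hν).1, (X.isCompact_singularSlice hν).2,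
    X.hausdorffMeasure_one_singularSlice_eq_zero_of_force_eq_zero hν hf⟩

end ClayBlowup

namespace DesignedBlowup

variable {ν : ℝ} (D : DesignedBlowup ν)

/-- **The singular slice of an unforced designed blow-up has one-dimensional Hausdorff measure zero**
(`ν > 0`, `D.f = 0`; `toClayBlowup`). [cite: CaffarelliKohnNirenberg1982, Theorem B (§6, p. 807)] -/
theorem hausdorffMeasure_one_singularSlice_eq_zero_of_force_eq_zero (hν : 0 < ν) (hf : D.f = 0) :
    μH[1] {x₀ : EuclideanSpace ℝ (Fin 3) | ¬ IsBackwardBoundedAt D.u D.T x₀} = 0 :=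
  D.toClayBlowup.hausdorffMeasure_one_singularSlice_eq_zero_of_force_eq_zero hν hf

end DesignedBlowup

/-! ## §4 The (A)-side corollary -/

/-- **IF CLAY (A) FAILS, IT FAILS ON AN `ℋ¹`-NULL SET**: `¬ NavierStokesRegularity` implies that at
some (equivalently every) `ν > 0` there is an UNFORCED Clay blow-up, and every unforced Clay blow-up at
`ν > 0` has a nonempty compact singular slice of one-dimensional Hausdorff measure zero
(`navierStokesRegularity_iff_forall_clayBlowup_force_ne_zero` of g5 and the theorem above). Neither
`NavierStokesRegularity` nor its negation is asserted. [cite: FeffermanClay2006, (A)]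
[cite: CaffarelliKohnNirenberg1982, Theorem B (§6, p. 807)] -/
theorem exists_unforced_clayBlowup_of_not_navierStokesRegularity
    (h : ¬ _root_.NavierStokesRegularity) :
    (∃ ν : ℝ, 0 < ν ∧ ∃ X : ClayBlowup ν, X.f = 0) ∧
      ∀ ν : ℝ, 0 < ν → ∀ X : ClayBlowup ν, X.f = 0 →
        IsCompact {x₀ : EuclideanSpace ℝ (Fin 3) | ¬ IsBackwardBoundedAt X.u X.T x₀} ∧
          {x₀ : EuclideanSpace ℝ (Fin 3) | ¬ IsBackwardBoundedAt X.u X.T x₀}.Nonempty ∧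
            μH[1] {x₀ : EuclideanSpace ℝ (Fin 3) | ¬ IsBackwardBoundedAt X.u X.T x₀} = 0 := by
  refine ⟨?_, fun ν hν X hf => X.singularSlice_compact_nonempty_hausdorffOne_null_of_force_eq_zero hν hf⟩
  rw [navierStokesRegularity_iff_forall_clayBlowup_force_ne_zero] at h
  push Not at h
  exact h

end Summit.NavierStokesRegularity.FluidComputer

end
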